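import Summits.CriticalPhenomena.PercolationContinuityZ3.Theorems.PercNearOneGluingNoHeavyLowerTailIncStarTwoSepMoments
import HarnessLib

/-!
# The two-separation gluing theorem for the increasing star, IV: the pendant realisation and the three-ray identity

Support file for the Sahi programme (`--supports stmt-CriticalPhenomena-4575`, prover prim-sahi-p2 gen 23).  No definitions, no named
facts, no sorries; standard axioms.  Memo `run/shared/lean/prim/prim-sahi/FROM-prim-sahi-p2-gen22-TWO-SEPARATION-GLUING.md` §1,
`prim-sahi-p2/PROOF-E3.md` §32–§33.

Setting of `…IncStarTwoSepEvents` / `…IncStarTwoSepMoments`: root `s`, `x ≠ s`, near side `L` (`s, x ∉ L`), no positive pair between `L`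
and `V ∖ (L ∪ {s,x})`, targets `a ∈ L`, `b, c ∉ L ∪ {s}`; `λ = P(Λ)` is the probability that the root reaches `x` through the near side.
The PENDANT REALISATION `w*` of the near side keeps the far pairs of `w` and replaces the near side by the single vertex `a` hanging off
`x`: `w*(x,a) = 1`, `w*(s,a) = λ`, every other pair at `L` has weight `0` (memo §1: the vertex `a′` realising the ray `(λ, λ, 1−λ)` of the
near cone).
* `twoSep_pendant_near`: the near numbers of `w*` are `(α, α_Λ, d_a, λ) = (λ, λ, 1−λ, λ)`; `real_eq_of_agree_off`: its far numbers are
  those of `w`; hence (`twoSep_pendant_sahiE3_eq`, (I1) of `…IncStarTwoSepMoments`) `E₃^{w*}(a,b,c) = λU + λBR2 + (1−λ)TD = STAR⁺`.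
* `twoSep_threeRay_sahiE3` — the **THREE-RAY IDENTITY** at the level of events:
  `(1−λ)·E₃^w(a,b,c) = (α_Λ − λα − λd_a)·Φ + (α − α_Λ)·CovLam + d_a·E₃^{w*}(a,b,c)`,
  `Φ = Cov(B⁺b,B⁺c) + (1−λ)σ + (1−λ)²d_bd_c ≥ 0`, `CovLam = (1−λ)Cov(Bb,Bc) + λCov(B⁺b,B⁺c) + λ(1−λ)d_bd_c ≥ 0`, `α_Λ − λα − λd_a ≥ 0` (L2),
  `α − α_Λ ≥ 0` — Harris four times.
* `incStar_nonneg_of_twoSep_pendant` — **THEOREM G, pendant form**: `0 ≤ E₃^{w*}(a,b,c) ⟹ 0 ≤ E₃^{w}(a,b,c)`.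
The boosted-root form (merging `a` into `x` by the series reduction) is `…IncStarTwoSepGlue`.
-/

noncomputable section

namespace Summit.CriticalPhenomena.PercolationContinuityZ3.Theorems

namespace IncStar

open MeasureTheory Set Literature.Probability.Percolation Literature.Probability.LatticeModels
open scoped Classical

variable {n : ℕ}

/-! ### Far numbers do not see the near weights -/

/-- Weights agreeing on the pairs avoiding `L` give the same probability to every far event. [folklore] -/
theorem real_eq_of_agree_off (w w' : Sym2 (Fin n) → unitInterval) (L : Set (Fin n)) {s : Fin n} (hsL : s ∉ L)
    (hagree : ∀ e : Sym2 (Fin n), (∀ v ∈ e, v ∉ L) → w' e = w e) {A : Set (BondConfig (Fin n))}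
    (hA : DeterminedBy A ({z : Sym2 (Fin n) | ¬ z.IsDiag ∧ ∀ v ∈ z, v ∈ {y : Fin n | y ∉ L ∧ y ≠ s}}
      ∪ {z | ∃ u ∈ {y : Fin n | y ∉ L ∧ y ≠ s}, z = s(s, u)})) :
    (prodBernoulli w').real A = (prodBernoulli w).real A :=
  prodBernoulli_real_eq_of_determinedBy w' w (fun e he => hagree e (far_pairs_avoid L s hsL he)) hA MeasurableSet.of_discrete

/-! ### The pendant realisation of the ray `(λ, λ, 1 − λ)` -/

/-- **Near numbers of the pendant realisation.**  If `a ∈ L`, `w*(x, a) = 1` and every root pair into `L ∖ {a}` has weight `0`, then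
with `q = w*(s, a)`: `P(A a) = q`, `P(A a ∩ Λ) = q`, `P(F a ∖ Λ) = 1 − q`, `P(Λ) = q`. [this work] -/
theorem twoSep_pendant_near (wS : Sym2 (Fin n) → unitInterval) (L : Set (Fin n)) {s x a : Fin n}
    (hxL : x ∉ L) (haL : a ∈ L) (h1 : wS s(x, a) = 1) (h0 : ∀ u ∈ L, u ≠ a → wS s(s, u) = 0) :
    (prodBernoulli wS).real {ω : BondConfig (Fin n) | ∃ u ∈ L, s(s, u) ∈ ω ∧ ω ∈ openConnIn (insert x L) u a} = wS s(s, a)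
    ∧ (prodBernoulli wS).real ({ω : BondConfig (Fin n) | ∃ u ∈ L, s(s, u) ∈ ω ∧ ω ∈ openConnIn (insert x L) u a}
        ∩ {ω : BondConfig (Fin n) | ∃ u ∈ L, s(s, u) ∈ ω ∧ ω ∈ openConnIn (insert x L) u x}) = wS s(s, a)
    ∧ (prodBernoulli wS).real (openConnIn (insert x L) x a
        \ {ω : BondConfig (Fin n) | ∃ u ∈ L, s(s, u) ∈ ω ∧ ω ∈ openConnIn (insert x L) u x}) = 1 - wS s(s, a)
    ∧ (prodBernoulli wS).real {ω : BondConfig (Fin n) | ∃ u ∈ L, s(s, u) ∈ ω ∧ ω ∈ openConnIn (insert x L) u x} = wS s(s, a) := by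
  have hax : a ≠ x := fun h => hxL (h ▸ haL)
  have ha1 : a ∈ (insert x L : Set (Fin n)) := Set.mem_insert_of_mem x haL
  have hx1 : x ∈ (insert x L : Set (Fin n)) := Set.mem_insert x L
  set G : Set (BondConfig (Fin n)) := {ω | ∀ e, wS e = 1 → e ∈ ω} ∩ {ω | ∀ e, wS e = 0 → e ∉ ω}
  have hG1 : (prodBernoulli wS).real G = 1 := real_sureSet wS
  have hxa : ∀ ω ∈ G, s(x, a) ∈ ω := fun ω hω => hω.1 _ h1
  have hfirst : ∀ ω ∈ G, ∀ u ∈ L, s(s, u) ∈ ω → u = a := by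
    intro ω hω u hu hsu
    by_contra hne
    exact hω.2 _ (h0 u hu hne) hsu
  have eA : ∀ ω ∈ G, (ω ∈ {ω : BondConfig (Fin n) | ∃ u ∈ L, s(s, u) ∈ ω ∧ ω ∈ openConnIn (insert x L) u a}
      ↔ ω ∈ {ω : BondConfig (Fin n) | s(s, a) ∈ ω}) := by
    intro ω hω
    constructor
    · rintro ⟨u, hu, hsu, -⟩
      have := hfirst ω hω u hu hsu
      subst this
      exact hsu
    · intro h
      exact ⟨a, haL, h, Literature.Probability.Percolation.openConnIn_refl ha1⟩
  have eX : ∀ ω ∈ G, (ω ∈ {ω : BondConfig (Fin n) | ∃ u ∈ L, s(s, u) ∈ ω ∧ ω ∈ openConnIn (insert x L) u x}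
      ↔ ω ∈ {ω : BondConfig (Fin n) | s(s, a) ∈ ω}) := by
    intro ω hω
    constructor
    · rintro ⟨u, hu, hsu, -⟩
      have := hfirst ω hω u hu hsu
      subst this
      exact hsu
    · intro h
      refine ⟨a, haL, h, Literature.Probability.Percolation.openConnIn_of_adj ha1 hx1 ?_ hax⟩
      rw [Sym2.eq_swap]; exact hxa ω hω
  have eF : ∀ ω ∈ G, ω ∈ openConnIn (insert x L) x a := fun ω hω => Literature.Probability.Percolation.openConnIn_of_adj hx1 ha1 (hxa ω hω) hax.symm
  refine ⟨?_, ?_, ?_, ?_⟩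
  · rw [real_congr_of_sure hG1 eA]; exact prodBernoulli_real_setOf_mem wS _
  · rw [← prodBernoulli_real_setOf_mem wS s(s, a)]
    refine real_congr_of_sure hG1 fun ω hω => ?_
    rw [Set.mem_inter_iff, eA ω hω, eX ω hω, and_self]
  · rw [← prodBernoulli_real_setOf_notMem wS s(s, a)]
    refine real_congr_of_sure hG1 fun ω hω => ?_
    rw [Set.mem_sdiff, eX ω hω]
    exact ⟨fun h => h.2, fun h => ⟨eF ω hω, h⟩⟩
  · rw [real_congr_of_sure hG1 eX]; exact prodBernoulli_real_setOf_mem wS _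

/-! ### The star of the pendant realisation -/

/-- **`E₃` of the pendant realisation is `STAR⁺ = λU + λBR2 + (1−λ)TD`** (the value of (I1) on the ray `(λ, λ, 1−λ)`), with the far
numbers of `w` (the far events do not see the near weights) — memo §1 (I4). [this work] -/
theorem twoSep_pendant_sahiE3_eq (w wS : Sym2 (Fin n) → unitInterval) (L : Set (Fin n)) {s x a b c : Fin n}
    (hxs : x ≠ s) (hsL : s ∉ L) (hxL : x ∉ L) (haL : a ∈ L) (hbL : b ∉ L) (hbs : b ≠ s) (hcL : c ∉ L) (hcs : c ≠ s)
    (hfar : ∀ e : Sym2 (Fin n), (∀ v ∈ e, v ∉ L) → wS e = w e) (h1 : wS s(x, a) = 1)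
    (h0 : ∀ u ∈ L, u ≠ a → wS s(s, u) = 0)
    (hq : (wS s(s, a) : ℝ) = (prodBernoulli w).real {ω : BondConfig (Fin n) | ∃ u ∈ L, s(s, u) ∈ ω ∧ ω ∈ openConnIn (insert x L) u x})
    (hScross : ∀ y z : Fin n, y ∈ L → z ∉ L → z ≠ s → z ≠ x → wS s(y, z) = 0)
    {lam β γ ρ db dc mbc σ ρb ρc ρbc : ℝ}
    (hlam : lam = (prodBernoulli w).real {ω : BondConfig (Fin n) | ∃ u ∈ L, s(s, u) ∈ ω ∧ ω ∈ openConnIn (insert x L) u x})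
    (hβ : β = (prodBernoulli w).real
      {ω : BondConfig (Fin n) | ∃ u ∈ {y : Fin n | y ∉ L ∧ y ≠ s}, s(s, u) ∈ ω ∧ ω ∈ openConnIn {y | y ∉ L ∧ y ≠ s} u b})
    (hγ : γ = (prodBernoulli w).real
      {ω : BondConfig (Fin n) | ∃ u ∈ {y : Fin n | y ∉ L ∧ y ≠ s}, s(s, u) ∈ ω ∧ ω ∈ openConnIn {y | y ∉ L ∧ y ≠ s} u c})
    (hρ : ρ = (prodBernoulli w).real
      {ω : BondConfig (Fin n) | ∃ u ∈ {y : Fin n | y ∉ L ∧ y ≠ s}, s(s, u) ∈ ω ∧ ω ∈ openConnIn {y | y ∉ L ∧ y ≠ s} u x})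
    (hdb : db = (prodBernoulli w).real (openConnIn {y | y ∉ L ∧ y ≠ s} x b
      \ {ω : BondConfig (Fin n) | ∃ u ∈ {y : Fin n | y ∉ L ∧ y ≠ s}, s(s, u) ∈ ω ∧ ω ∈ openConnIn {y | y ∉ L ∧ y ≠ s} u x}))
    (hdc : dc = (prodBernoulli w).real (openConnIn {y | y ∉ L ∧ y ≠ s} x c
      \ {ω : BondConfig (Fin n) | ∃ u ∈ {y : Fin n | y ∉ L ∧ y ≠ s}, s(s, u) ∈ ω ∧ ω ∈ openConnIn {y | y ∉ L ∧ y ≠ s} u x}))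
    (hmbc : mbc = (prodBernoulli w).real
      ({ω : BondConfig (Fin n) | ∃ u ∈ {y : Fin n | y ∉ L ∧ y ≠ s}, s(s, u) ∈ ω ∧ ω ∈ openConnIn {y | y ∉ L ∧ y ≠ s} u b}
        ∩ {ω : BondConfig (Fin n) | ∃ u ∈ {y : Fin n | y ∉ L ∧ y ≠ s}, s(s, u) ∈ ω ∧ ω ∈ openConnIn {y | y ∉ L ∧ y ≠ s} u c}))
    (hσ : σ = (prodBernoulli w).real
      ((({ω : BondConfig (Fin n) | ∃ u ∈ {y : Fin n | y ∉ L ∧ y ≠ s}, s(s, u) ∈ ω ∧ ω ∈ openConnIn {y | y ∉ L ∧ y ≠ s} u b}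
            ∪ openConnIn {y | y ∉ L ∧ y ≠ s} x b)
          ∩ ({ω : BondConfig (Fin n) | ∃ u ∈ {y : Fin n | y ∉ L ∧ y ≠ s}, s(s, u) ∈ ω ∧ ω ∈ openConnIn {y | y ∉ L ∧ y ≠ s} u c}
            ∪ openConnIn {y | y ∉ L ∧ y ≠ s} x c))
        \ ({ω : BondConfig (Fin n) | ∃ u ∈ {y : Fin n | y ∉ L ∧ y ≠ s}, s(s, u) ∈ ω ∧ ω ∈ openConnIn {y | y ∉ L ∧ y ≠ s} u b}
          ∩ {ω : BondConfig (Fin n) | ∃ u ∈ {y : Fin n | y ∉ L ∧ y ≠ s}, s(s, u) ∈ ω ∧ ω ∈ openConnIn {y | y ∉ L ∧ y ≠ s} u c})))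
    (hρb : ρb = (prodBernoulli w).real
      ({ω : BondConfig (Fin n) | ∃ u ∈ {y : Fin n | y ∉ L ∧ y ≠ s}, s(s, u) ∈ ω ∧ ω ∈ openConnIn {y | y ∉ L ∧ y ≠ s} u x}
        ∩ {ω : BondConfig (Fin n) | ∃ u ∈ {y : Fin n | y ∉ L ∧ y ≠ s}, s(s, u) ∈ ω ∧ ω ∈ openConnIn {y | y ∉ L ∧ y ≠ s} u b}))
    (hρc : ρc = (prodBernoulli w).real
      ({ω : BondConfig (Fin n) | ∃ u ∈ {y : Fin n | y ∉ L ∧ y ≠ s}, s(s, u) ∈ ω ∧ ω ∈ openConnIn {y | y ∉ L ∧ y ≠ s} u x}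
        ∩ {ω : BondConfig (Fin n) | ∃ u ∈ {y : Fin n | y ∉ L ∧ y ≠ s}, s(s, u) ∈ ω ∧ ω ∈ openConnIn {y | y ∉ L ∧ y ≠ s} u c}))
    (hρbc : ρbc = (prodBernoulli w).real
      ({ω : BondConfig (Fin n) | ∃ u ∈ {y : Fin n | y ∉ L ∧ y ≠ s}, s(s, u) ∈ ω ∧ ω ∈ openConnIn {y | y ∉ L ∧ y ≠ s} u x}
        ∩ ({ω : BondConfig (Fin n) | ∃ u ∈ {y : Fin n | y ∉ L ∧ y ≠ s}, s(s, u) ∈ ω ∧ ω ∈ openConnIn {y | y ∉ L ∧ y ≠ s} u b}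
          ∩ {ω : BondConfig (Fin n) | ∃ u ∈ {y : Fin n | y ∉ L ∧ y ≠ s}, s(s, u) ∈ ω ∧ ω ∈ openConnIn {y | y ∉ L ∧ y ≠ s} u c}))) :
    sahiE3 (prodBernoulli wS) (openConn s a) (openConn s b) (openConn s c)
      = lam * ((mbc - β * γ) - lam * σ + lam ^ 2 * (db * dc))
        + lam * (2 * σ - β * dc - γ * db - 2 * lam * (db * dc))
        + (1 - lam) * ((2 * ρbc - ρ * mbc - β * ρc - γ * ρb + ρ * β * γ)
            + lam * (ρ * (β * dc + γ * db - σ) - db * ρc - dc * ρb) + lam ^ 2 * (ρ * db * dc)) := by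
  have haV : a ∈ (insert x L : Set (Fin n)) := Set.mem_insert_of_mem x haL
  have far : ∀ {A : Set (BondConfig (Fin n))}, DeterminedBy A ({z : Sym2 (Fin n) | ¬ z.IsDiag ∧ ∀ v ∈ z, v ∈ {y : Fin n | y ∉ L ∧ y ≠ s}}
        ∪ {z | ∃ u ∈ {y : Fin n | y ∉ L ∧ y ≠ s}, z = s(s, u)}) →
      (prodBernoulli wS).real A = (prodBernoulli w).real A := fun hA => real_eq_of_agree_off w wS L hsL hfar hA
  have hdiff : ∀ {A B : Set (BondConfig (Fin n))} {K' : Set (Sym2 (Fin n))},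
      DeterminedBy A K' → DeterminedBy B K' → DeterminedBy (A \ B) K' := by
    intro A B K' hA hB
    rw [determinedBy_iff] at hA hB ⊢
    intro ω ω' h
    rw [Set.mem_sdiff, Set.mem_sdiff, hA ω ω' h, hB ω ω' h]
  have hunion : ∀ {A B : Set (BondConfig (Fin n))} {K' : Set (Sym2 (Fin n))},
      DeterminedBy A K' → DeterminedBy B K' → DeterminedBy (A ∪ B) K' := by
    intro A B K' hA hB
    rw [determinedBy_iff] at hA hB ⊢
    intro ω ω' h
    rw [Set.mem_union, Set.mem_union, hA ω ω' h, hB ω ω' h]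
  have dB : ∀ t : Fin n, DeterminedBy
      {ω : BondConfig (Fin n) | ∃ u ∈ {y : Fin n | y ∉ L ∧ y ≠ s}, s(s, u) ∈ ω ∧ ω ∈ openConnIn {y | y ∉ L ∧ y ≠ s} u t}
      ({z : Sym2 (Fin n) | ¬ z.IsDiag ∧ ∀ v ∈ z, v ∈ {y : Fin n | y ∉ L ∧ y ≠ s}}
        ∪ {z | ∃ u ∈ {y : Fin n | y ∉ L ∧ y ≠ s}, z = s(s, u)}) := fun t => determinedBy_rootStar_far L s t
  have dF : ∀ t : Fin n, DeterminedBy (openConnIn {y | y ∉ L ∧ y ≠ s} x t : Set (BondConfig (Fin n)))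
      ({z : Sym2 (Fin n) | ¬ z.IsDiag ∧ ∀ v ∈ z, v ∈ {y : Fin n | y ∉ L ∧ y ≠ s}}
        ∪ {z | ∃ u ∈ {y : Fin n | y ∉ L ∧ y ≠ s}, z = s(s, u)}) := fun t => determinedBy_port_far L s x t
  obtain ⟨nA, nAX, nD, nX⟩ := twoSep_pendant_near wS L hxL haL h1 h0
  exact twoSep_sahiE3_eq wS L hxs hsL hxL haV hbL hbs hcL hcs hScross
    (α := lam) (αΛ := lam) (da := 1 - lam) (lam := lam) (β := β) (γ := γ) (ρ := ρ) (db := db) (dc := dc) (mbc := mbc)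
    (σ := σ) (ρb := ρb) (ρc := ρc) (ρbc := ρbc)
    (by rw [nA, hq, hlam]) (by rw [nAX, hq, hlam]) (by rw [nD, hq, hlam]) (by rw [nX, hq, hlam])
    (by rw [far (dB b), hβ]) (by rw [far (dB c), hγ]) (by rw [far (dB x), hρ])
    (by rw [far (hdiff (dF b) (dB x)), hdb]) (by rw [far (hdiff (dF c) (dB x)), hdc])
    (by rw [far ((dB b).inter (dB c)), hmbc])
    (by rw [far (hdiff ((hunion (dB b) (dF b)).inter (hunion (dB c) (dF c))) ((dB b).inter (dB c))), hσ])
    (by rw [far ((dB x).inter (dB b)), hρb]) (by rw [far ((dB x).inter (dB c)), hρc])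
    (by rw [far ((dB x).inter ((dB b).inter (dB c))), hρbc])

/-! ### THEOREM G, pendant form -/

/-- **The three-ray identity at the level of events.**  With the pendant realisation `w*` of the near side (far pairs as in `w`,
`w*(x,a) = 1`, `w*(s,a) = λ = P(Λ)`, all other pairs at `L` of weight `0`):
`(1−λ)·E₃^w(a,b,c) = (α_Λ − λα − λd_a)·Φ + (α − α_Λ)·CovLam + d_a·E₃^{w*}(a,b,c)`, where
`Φ = Cov(B⁺b,B⁺c) + (1−λ)σ + (1−λ)²d_bd_c` and `CovLam = (1−λ)Cov(B b,B c) + λCov(B⁺b,B⁺c) + λ(1−λ)d_bd_c` (memo §1, THREE-RAY IDENTITY;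
the near/far numbers are supplied through defining hypotheses as in `twoSep_sahiE3_eq`). [this work] -/
theorem twoSep_threeRay_sahiE3 (w wS : Sym2 (Fin n) → unitInterval) (L : Set (Fin n)) {s x a b c : Fin n}
    (hxs : x ≠ s) (hsL : s ∉ L) (hxL : x ∉ L) (haL : a ∈ L) (hbL : b ∉ L) (hbs : b ≠ s) (hcL : c ∉ L) (hcs : c ≠ s)
    (hcross : ∀ y z : Fin n, y ∈ L → z ∉ L → z ≠ s → z ≠ x → w s(y, z) = 0)
    (hfar : ∀ e : Sym2 (Fin n), (∀ v ∈ e, v ∉ L) → wS e = w e) (h1 : wS s(x, a) = 1)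
    (h0 : ∀ u ∈ L, u ≠ a → wS s(s, u) = 0)
    (hq : (wS s(s, a) : ℝ) = (prodBernoulli w).real {ω : BondConfig (Fin n) | ∃ u ∈ L, s(s, u) ∈ ω ∧ ω ∈ openConnIn (insert x L) u x})
    (hScross : ∀ y z : Fin n, y ∈ L → z ∉ L → z ≠ s → z ≠ x → wS s(y, z) = 0)
    {α αΛ da lam β γ db dc mbc σ : ℝ}
    (hα : α = (prodBernoulli w).real {ω : BondConfig (Fin n) | ∃ u ∈ L, s(s, u) ∈ ω ∧ ω ∈ openConnIn (insert x L) u a})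
    (hαΛ : αΛ = (prodBernoulli w).real ({ω : BondConfig (Fin n) | ∃ u ∈ L, s(s, u) ∈ ω ∧ ω ∈ openConnIn (insert x L) u a}
      ∩ {ω : BondConfig (Fin n) | ∃ u ∈ L, s(s, u) ∈ ω ∧ ω ∈ openConnIn (insert x L) u x}))
    (hda : da = (prodBernoulli w).real (openConnIn (insert x L) x a
      \ {ω : BondConfig (Fin n) | ∃ u ∈ L, s(s, u) ∈ ω ∧ ω ∈ openConnIn (insert x L) u x}))
    (hlam : lam = (prodBernoulli w).real {ω : BondConfig (Fin n) | ∃ u ∈ L, s(s, u) ∈ ω ∧ ω ∈ openConnIn (insert x L) u x})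
    (hβ : β = (prodBernoulli w).real
      {ω : BondConfig (Fin n) | ∃ u ∈ {y : Fin n | y ∉ L ∧ y ≠ s}, s(s, u) ∈ ω ∧ ω ∈ openConnIn {y | y ∉ L ∧ y ≠ s} u b})
    (hγ : γ = (prodBernoulli w).real
      {ω : BondConfig (Fin n) | ∃ u ∈ {y : Fin n | y ∉ L ∧ y ≠ s}, s(s, u) ∈ ω ∧ ω ∈ openConnIn {y | y ∉ L ∧ y ≠ s} u c})
    (hdb : db = (prodBernoulli w).real (openConnIn {y | y ∉ L ∧ y ≠ s} x b
      \ {ω : BondConfig (Fin n) | ∃ u ∈ {y : Fin n | y ∉ L ∧ y ≠ s}, s(s, u) ∈ ω ∧ ω ∈ openConnIn {y | y ∉ L ∧ y ≠ s} u x}))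
    (hdc : dc = (prodBernoulli w).real (openConnIn {y | y ∉ L ∧ y ≠ s} x c
      \ {ω : BondConfig (Fin n) | ∃ u ∈ {y : Fin n | y ∉ L ∧ y ≠ s}, s(s, u) ∈ ω ∧ ω ∈ openConnIn {y | y ∉ L ∧ y ≠ s} u x}))
    (hmbc : mbc = (prodBernoulli w).real
      ({ω : BondConfig (Fin n) | ∃ u ∈ {y : Fin n | y ∉ L ∧ y ≠ s}, s(s, u) ∈ ω ∧ ω ∈ openConnIn {y | y ∉ L ∧ y ≠ s} u b}
        ∩ {ω : BondConfig (Fin n) | ∃ u ∈ {y : Fin n | y ∉ L ∧ y ≠ s}, s(s, u) ∈ ω ∧ ω ∈ openConnIn {y | y ∉ L ∧ y ≠ s} u c}))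
    (hσ : σ = (prodBernoulli w).real
      ((({ω : BondConfig (Fin n) | ∃ u ∈ {y : Fin n | y ∉ L ∧ y ≠ s}, s(s, u) ∈ ω ∧ ω ∈ openConnIn {y | y ∉ L ∧ y ≠ s} u b}
            ∪ openConnIn {y | y ∉ L ∧ y ≠ s} x b)
          ∩ ({ω : BondConfig (Fin n) | ∃ u ∈ {y : Fin n | y ∉ L ∧ y ≠ s}, s(s, u) ∈ ω ∧ ω ∈ openConnIn {y | y ∉ L ∧ y ≠ s} u c}
            ∪ openConnIn {y | y ∉ L ∧ y ≠ s} x c))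
        \ ({ω : BondConfig (Fin n) | ∃ u ∈ {y : Fin n | y ∉ L ∧ y ≠ s}, s(s, u) ∈ ω ∧ ω ∈ openConnIn {y | y ∉ L ∧ y ≠ s} u b}
          ∩ {ω : BondConfig (Fin n) | ∃ u ∈ {y : Fin n | y ∉ L ∧ y ≠ s}, s(s, u) ∈ ω ∧ ω ∈ openConnIn {y | y ∉ L ∧ y ≠ s} u c}))) :
    (1 - lam) * sahiE3 (prodBernoulli w) (openConn s a) (openConn s b) (openConn s c)
      = (αΛ - lam * α - lam * da) * (((mbc + σ) - (β + db) * (γ + dc)) + (1 - lam) * σ + (1 - lam) ^ 2 * (db * dc))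
        + (α - αΛ) * ((1 - lam) * (mbc - β * γ) + lam * ((mbc + σ) - (β + db) * (γ + dc)) + lam * (1 - lam) * (db * dc))
        + da * sahiE3 (prodBernoulli wS) (openConn s a) (openConn s b) (openConn s c) := by
  have haV : a ∈ (insert x L : Set (Fin n)) := Set.mem_insert_of_mem x haL
  -- the far numbers of `w` not named in the statement
  obtain ⟨ρ, hρ⟩ : ∃ r : ℝ, r = (prodBernoulli w).real
      {ω : BondConfig (Fin n) | ∃ u ∈ {y : Fin n | y ∉ L ∧ y ≠ s}, s(s, u) ∈ ω ∧ ω ∈ openConnIn {y | y ∉ L ∧ y ≠ s} u x} := ⟨_, rfl⟩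
  obtain ⟨ρb, hρb⟩ : ∃ r : ℝ, r = (prodBernoulli w).real
      ({ω : BondConfig (Fin n) | ∃ u ∈ {y : Fin n | y ∉ L ∧ y ≠ s}, s(s, u) ∈ ω ∧ ω ∈ openConnIn {y | y ∉ L ∧ y ≠ s} u x}
        ∩ {ω : BondConfig (Fin n) | ∃ u ∈ {y : Fin n | y ∉ L ∧ y ≠ s}, s(s, u) ∈ ω ∧ ω ∈ openConnIn {y | y ∉ L ∧ y ≠ s} u b}) := ⟨_, rfl⟩
  obtain ⟨ρc, hρc⟩ : ∃ r : ℝ, r = (prodBernoulli w).real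
      ({ω : BondConfig (Fin n) | ∃ u ∈ {y : Fin n | y ∉ L ∧ y ≠ s}, s(s, u) ∈ ω ∧ ω ∈ openConnIn {y | y ∉ L ∧ y ≠ s} u x}
        ∩ {ω : BondConfig (Fin n) | ∃ u ∈ {y : Fin n | y ∉ L ∧ y ≠ s}, s(s, u) ∈ ω ∧ ω ∈ openConnIn {y | y ∉ L ∧ y ≠ s} u c}) := ⟨_, rfl⟩
  obtain ⟨ρbc, hρbc⟩ : ∃ r : ℝ, r = (prodBernoulli w).real
      ({ω : BondConfig (Fin n) | ∃ u ∈ {y : Fin n | y ∉ L ∧ y ≠ s}, s(s, u) ∈ ω ∧ ω ∈ openConnIn {y | y ∉ L ∧ y ≠ s} u x}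
        ∩ ({ω : BondConfig (Fin n) | ∃ u ∈ {y : Fin n | y ∉ L ∧ y ≠ s}, s(s, u) ∈ ω ∧ ω ∈ openConnIn {y | y ∉ L ∧ y ≠ s} u b}
          ∩ {ω : BondConfig (Fin n) | ∃ u ∈ {y : Fin n | y ∉ L ∧ y ≠ s}, s(s, u) ∈ ω ∧ ω ∈ openConnIn {y | y ∉ L ∧ y ≠ s} u c})) := ⟨_, rfl⟩
  rw [twoSep_sahiE3_eq w L hxs hsL hxL haV hbL hbs hcL hcs hcross hα hαΛ hda hlam hβ hγ hρ hdb hdc hmbc hσ hρb hρc hρbc,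
    twoSep_pendant_sahiE3_eq w wS L hxs hsL hxL haL hbL hbs hcL hcs hfar h1 h0 hq hScross hlam hβ hγ hρ hdb hdc hmbc hσ
      hρb hρc hρbc]
  ring

/-- **THEOREM G, pendant form**: with the pendant realisation `w*` of the near side (far pairs as in `w`, `w*(x,a) = 1`,
`w*(s,a) = λ = P(Λ)`, all other pairs at `L` of weight `0`), `0 ≤ E₃^{w*}(a,b,c) ⟹ 0 ≤ E₃^{w}(a,b,c)`.  Inputs: (I1) for `w` and for `w*`,
`twoSep_threeRay_nonneg`, Harris on the near side (`d_a ≥ 0`, `α_Λ ≤ α`, (L2) `λ(α + d_a) ≤ α_Λ`) and on the far side (`Φ, CovLam ≥ 0`).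
[this work] -/
theorem incStar_nonneg_of_twoSep_pendant (w wS : Sym2 (Fin n) → unitInterval) (L : Set (Fin n)) {s x a b c : Fin n}
    (hxs : x ≠ s) (hsL : s ∉ L) (hxL : x ∉ L) (haL : a ∈ L) (hbL : b ∉ L) (hbs : b ≠ s) (hcL : c ∉ L) (hcs : c ≠ s)
    (hcross : ∀ y z : Fin n, y ∈ L → z ∉ L → z ≠ s → z ≠ x → w s(y, z) = 0)
    (hfar : ∀ e : Sym2 (Fin n), (∀ v ∈ e, v ∉ L) → wS e = w e) (h1 : wS s(x, a) = 1)
    (h0 : ∀ u ∈ L, u ≠ a → wS s(s, u) = 0)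
    (hq : (wS s(s, a) : ℝ) = (prodBernoulli w).real {ω : BondConfig (Fin n) | ∃ u ∈ L, s(s, u) ∈ ω ∧ ω ∈ openConnIn (insert x L) u x})
    (hScross : ∀ y z : Fin n, y ∈ L → z ∉ L → z ≠ s → z ≠ x → wS s(y, z) = 0)
    (hstar : 0 ≤ sahiE3 (prodBernoulli wS) (openConn s a) (openConn s b) (openConn s c)) :
    0 ≤ sahiE3 (prodBernoulli w) (openConn s a) (openConn s b) (openConn s c) := by
  have hm : ∀ X : Set (BondConfig (Fin n)), MeasurableSet X := fun _ => MeasurableSet.of_discrete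
  have haV : a ∈ (insert x L : Set (Fin n)) := Set.mem_insert_of_mem x haL
  -- the near and far numbers of `w` (opaque reals with defining equations)
  obtain ⟨α, hα⟩ : ∃ r : ℝ, r = (prodBernoulli w).real
      {ω : BondConfig (Fin n) | ∃ u ∈ L, s(s, u) ∈ ω ∧ ω ∈ openConnIn (insert x L) u a} := ⟨_, rfl⟩
  obtain ⟨αΛ, hαΛ⟩ : ∃ r : ℝ, r = (prodBernoulli w).real
      ({ω : BondConfig (Fin n) | ∃ u ∈ L, s(s, u) ∈ ω ∧ ω ∈ openConnIn (insert x L) u a}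
        ∩ {ω : BondConfig (Fin n) | ∃ u ∈ L, s(s, u) ∈ ω ∧ ω ∈ openConnIn (insert x L) u x}) := ⟨_, rfl⟩
  obtain ⟨da, hda⟩ : ∃ r : ℝ, r = (prodBernoulli w).real (openConnIn (insert x L) x a
      \ {ω : BondConfig (Fin n) | ∃ u ∈ L, s(s, u) ∈ ω ∧ ω ∈ openConnIn (insert x L) u x}) := ⟨_, rfl⟩
  obtain ⟨lam, hlam⟩ : ∃ r : ℝ, r = (prodBernoulli w).real
      {ω : BondConfig (Fin n) | ∃ u ∈ L, s(s, u) ∈ ω ∧ ω ∈ openConnIn (insert x L) u x} := ⟨_, rfl⟩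
  obtain ⟨β, hβ⟩ : ∃ r : ℝ, r = (prodBernoulli w).real
      {ω : BondConfig (Fin n) | ∃ u ∈ {y : Fin n | y ∉ L ∧ y ≠ s}, s(s, u) ∈ ω ∧ ω ∈ openConnIn {y | y ∉ L ∧ y ≠ s} u b} := ⟨_, rfl⟩
  obtain ⟨γ, hγ⟩ : ∃ r : ℝ, r = (prodBernoulli w).real
      {ω : BondConfig (Fin n) | ∃ u ∈ {y : Fin n | y ∉ L ∧ y ≠ s}, s(s, u) ∈ ω ∧ ω ∈ openConnIn {y | y ∉ L ∧ y ≠ s} u c} := ⟨_, rfl⟩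
  obtain ⟨ρ, hρ⟩ : ∃ r : ℝ, r = (prodBernoulli w).real
      {ω : BondConfig (Fin n) | ∃ u ∈ {y : Fin n | y ∉ L ∧ y ≠ s}, s(s, u) ∈ ω ∧ ω ∈ openConnIn {y | y ∉ L ∧ y ≠ s} u x} := ⟨_, rfl⟩
  obtain ⟨db, hdb⟩ : ∃ r : ℝ, r = (prodBernoulli w).real (openConnIn {y | y ∉ L ∧ y ≠ s} x b
      \ {ω : BondConfig (Fin n) | ∃ u ∈ {y : Fin n | y ∉ L ∧ y ≠ s}, s(s, u) ∈ ω ∧ ω ∈ openConnIn {y | y ∉ L ∧ y ≠ s} u x}) := ⟨_, rfl⟩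
  obtain ⟨dc, hdc⟩ : ∃ r : ℝ, r = (prodBernoulli w).real (openConnIn {y | y ∉ L ∧ y ≠ s} x c
      \ {ω : BondConfig (Fin n) | ∃ u ∈ {y : Fin n | y ∉ L ∧ y ≠ s}, s(s, u) ∈ ω ∧ ω ∈ openConnIn {y | y ∉ L ∧ y ≠ s} u x}) := ⟨_, rfl⟩
  obtain ⟨mbc, hmbc⟩ : ∃ r : ℝ, r = (prodBernoulli w).real
      ({ω : BondConfig (Fin n) | ∃ u ∈ {y : Fin n | y ∉ L ∧ y ≠ s}, s(s, u) ∈ ω ∧ ω ∈ openConnIn {y | y ∉ L ∧ y ≠ s} u b}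
        ∩ {ω : BondConfig (Fin n) | ∃ u ∈ {y : Fin n | y ∉ L ∧ y ≠ s}, s(s, u) ∈ ω ∧ ω ∈ openConnIn {y | y ∉ L ∧ y ≠ s} u c}) := ⟨_, rfl⟩
  obtain ⟨σ, hσ⟩ : ∃ r : ℝ, r = (prodBernoulli w).real
      ((({ω : BondConfig (Fin n) | ∃ u ∈ {y : Fin n | y ∉ L ∧ y ≠ s}, s(s, u) ∈ ω ∧ ω ∈ openConnIn {y | y ∉ L ∧ y ≠ s} u b}
            ∪ openConnIn {y | y ∉ L ∧ y ≠ s} x b)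
          ∩ ({ω : BondConfig (Fin n) | ∃ u ∈ {y : Fin n | y ∉ L ∧ y ≠ s}, s(s, u) ∈ ω ∧ ω ∈ openConnIn {y | y ∉ L ∧ y ≠ s} u c}
            ∪ openConnIn {y | y ∉ L ∧ y ≠ s} x c))
        \ ({ω : BondConfig (Fin n) | ∃ u ∈ {y : Fin n | y ∉ L ∧ y ≠ s}, s(s, u) ∈ ω ∧ ω ∈ openConnIn {y | y ∉ L ∧ y ≠ s} u b}
          ∩ {ω : BondConfig (Fin n) | ∃ u ∈ {y : Fin n | y ∉ L ∧ y ≠ s}, s(s, u) ∈ ω ∧ ω ∈ openConnIn {y | y ∉ L ∧ y ≠ s} u c})) := ⟨_, rfl⟩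
  obtain ⟨ρb, hρb⟩ : ∃ r : ℝ, r = (prodBernoulli w).real
      ({ω : BondConfig (Fin n) | ∃ u ∈ {y : Fin n | y ∉ L ∧ y ≠ s}, s(s, u) ∈ ω ∧ ω ∈ openConnIn {y | y ∉ L ∧ y ≠ s} u x}
        ∩ {ω : BondConfig (Fin n) | ∃ u ∈ {y : Fin n | y ∉ L ∧ y ≠ s}, s(s, u) ∈ ω ∧ ω ∈ openConnIn {y | y ∉ L ∧ y ≠ s} u b}) := ⟨_, rfl⟩
  obtain ⟨ρc, hρc⟩ : ∃ r : ℝ, r = (prodBernoulli w).real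
      ({ω : BondConfig (Fin n) | ∃ u ∈ {y : Fin n | y ∉ L ∧ y ≠ s}, s(s, u) ∈ ω ∧ ω ∈ openConnIn {y | y ∉ L ∧ y ≠ s} u x}
        ∩ {ω : BondConfig (Fin n) | ∃ u ∈ {y : Fin n | y ∉ L ∧ y ≠ s}, s(s, u) ∈ ω ∧ ω ∈ openConnIn {y | y ∉ L ∧ y ≠ s} u c}) := ⟨_, rfl⟩
  obtain ⟨ρbc, hρbc⟩ : ∃ r : ℝ, r = (prodBernoulli w).real
      ({ω : BondConfig (Fin n) | ∃ u ∈ {y : Fin n | y ∉ L ∧ y ≠ s}, s(s, u) ∈ ω ∧ ω ∈ openConnIn {y | y ∉ L ∧ y ≠ s} u x}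
        ∩ ({ω : BondConfig (Fin n) | ∃ u ∈ {y : Fin n | y ∉ L ∧ y ≠ s}, s(s, u) ∈ ω ∧ ω ∈ openConnIn {y | y ∉ L ∧ y ≠ s} u b}
          ∩ {ω : BondConfig (Fin n) | ∃ u ∈ {y : Fin n | y ∉ L ∧ y ≠ s}, s(s, u) ∈ ω ∧ ω ∈ openConnIn {y | y ∉ L ∧ y ≠ s} u c})) := ⟨_, rfl⟩
  -- (I1) for `w` and for `w*`
  have hE := twoSep_sahiE3_eq w L hxs hsL hxL haV hbL hbs hcL hcs hcross hα hαΛ hda hlam hβ hγ hρ hdb hdc hmbc hσ hρb hρc hρbc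
  have hES := twoSep_pendant_sahiE3_eq w wS L hxs hsL hxL haL hbL hbs hcL hcs hfar h1 h0 hq hScross hlam hβ hγ hρ hdb hdc
    hmbc hσ hρb hρc hρbc
  -- sign facts: Harris on both sides
  have hl0 : 0 ≤ lam := by rw [hlam]; exact measureReal_nonneg
  have hl1 : lam ≤ 1 := by rw [hlam]; exact measureReal_le_one
  have hα0 : 0 ≤ α := by rw [hα]; exact measureReal_nonneg
  have hda0 : 0 ≤ da := by rw [hda]; exact measureReal_nonneg
  have hαΛα : αΛ ≤ α := by rw [hα, hαΛ]; exact measureReal_mono Set.inter_subset_left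
  have hL2 : lam * (α + da) ≤ αΛ := by
    rw [hlam, hα, hda, hαΛ]; exact rootStar_port_harris w L (insert x L) s x a
  have hσ0 : 0 ≤ σ := by rw [hσ]; exact measureReal_nonneg
  have hdb0 : 0 ≤ db := by rw [hdb]; exact measureReal_nonneg
  have hdc0 : 0 ≤ dc := by rw [hdc]; exact measureReal_nonneg
  have hH0 : β * γ ≤ mbc := by
    rw [hβ, hγ, hmbc]
    exact prodBernoulli_harris w (isUpperSet_rootStar _ _ s b) (isUpperSet_rootStar _ _ s c) (hm _) (hm _)
  have hH1 : (β + db) * (γ + dc) ≤ mbc + σ := by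
    rw [hβ, hγ, hdb, hdc, hmbc, hσ]; exact rootStar_pair_harris w _ _ s x b c
  have hStar : 0 ≤ lam * (((mbc - β * γ) - lam * σ + lam ^ 2 * (db * dc)) + (2 * σ - β * dc - γ * db - 2 * lam * (db * dc)))
      + (1 - lam) * ((2 * ρbc - ρ * mbc - β * ρc - γ * ρb + ρ * β * γ)
          + lam * (ρ * (β * dc + γ * db - σ) - db * ρc - dc * ρb) + lam ^ 2 * (ρ * db * dc)) := by
    rw [hES] at hstar
    linarith
  rw [hE]
  exact twoSep_threeRay_nonneg lam α αΛ da _ _ _ hl0 hl1 hα0 hda0 hαΛα hL2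
    (twoSep_phi_nonneg lam β γ db dc mbc σ hl1 hσ0 hdb0 hdc0 hH1)
    (twoSep_covLam_nonneg lam β γ db dc mbc σ hl0 hl1 hdb0 hdc0 hH0 hH1) hStar

end IncStar

end Summit.CriticalPhenomena.PercolationContinuityZ3.Theorems
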